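import Literature.NumberTheory.LFunctions.DirichletLTruncationPacked
import Literature.NumberTheory.LFunctions.FeketePolyaKernelSignTablesWide
import HarnessLib

/-!
# Packed truncation certificate data for the conductor `14693` (cell group 3 of 21)

Kernel evaluation (`decide +kernel`) of one piece of the packed truncation certificate (Chua's ALGO 1, `K = 24` periods,
`G = 181`, `E = 2^13`, `P = 40`, digit width `72`; 164 graded cells: `h = 1/8192` on `[1/2, 0.506]`, `1/2048` to `0.545`,
`1/512` to `0.58`, `1/128` to `0.65`, `1/32` to `0.8`, `1/8` to `1`) for the even primitive quadratic character of conductor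
`14693 = 7·2099` (`B⁻ = 6812`); consumed by the soundness theorem of `LTruncationPacked.certTcells` / `certTframe`.
[cite: Chua2005RealZeros, §2.2 ALGO 1]
-/

namespace Literature.NumberTheory.LFunctions

namespace LTruncationPacked

open FeketePolyaKernel

set_option maxHeartbeats 0 in
/-- cell group 3 of 21: the check passes. [cite: Chua2005RealZeros, §2.2 ALGO 1] -/
theorem certTcells_14693_3 :
    certTcells 72 40 13 181 14693 24 6812
      [(4112, 1), (4113, 1), (4114, 1), (4115, 1), (4116, 1), (4117, 1), (4118, 1), (4119, 1)]
      (plainTabsC 0 72 47 [7, 2099] 14693) = true := by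
  decide +kernel

end LTruncationPacked

end Literature.NumberTheory.LFunctions
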